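import Summits.BirchSwinnertonDyer.Rank1Residual.Supersingular.RankOneRem13RecordShapesMinimality
import HarnessLib

/-!
# The schema point count in POW form (`b ^ e % ℓ` instead of the repeated-multiplication `powMod`),
# so that the kernel decides `#Ẽ(𝔽_p)` at the large supersingular primes of the rank-one census
# (cell `b2b-bsdres`, supersingular family prover B = unit `b2b-bsdres-additive-p3`, gen 20; TOOL)

HONEST FRAMING (run/shared/lean/b2b/bsd-rank1-residual/, verbatim in every file): the goal of the
cell is to DELETE the COMBINATION-SHAPED residual classes of the Birch–Swinnerton-Dyer formula for
ALL analytic-rank `≤ 1` elliptic curves over `ℚ` — "full BSD formula for every rank `≤ 1` curve in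
class `C`" assembled STRICTLY from published theorems — so that the rank-`≤ 1` remainder becomes
exactly the CONSTRUCTION-SHAPED classes, which are TYPED (missing-input `Prop`s), NOT attempted.
This is not "finishing BSD". THEOREMS ONLY (no definition, no named fact); nothing booked.

x11c's schema count `countPoints [a₁,…,a₆] ℓ = 1 + ∑_{x<ℓ} (1 + legendreSym(D(x), ℓ))` evaluates
Euler's criterion through `powMod r e ℓ` = a LEFT FOLD over `List.range e` (`e = (ℓ−1)/2`
multiplications, one list cell each): at `ℓ ≈ 1 200` the kernel runs out of memory (measured this
gen: `ℓ = 1151` ~40 s, `ℓ = 1559` fails). `countPoints_eq_powForm` rewrites the count ONCE into the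
same sum with `r ^ e % ℓ` (kernel big-number arithmetic) in place of `powMod` (`X11b.powMod_eq`), and
`natCard_point_eq_of_powForm` turns a decided pow-form value into `#Ẽ(𝔽_ℓ) = n`. Consumer: the
`hn : #Ẽ(𝔽_p) = p + 1` DATA binder of the 93 rank-one X7 records with `p ≥ 1031`
(`RankOneRem13RecordsX7Unit67–71/79`), discharged per row in `RankOneCountCertificatesX7_*.lean`.

References: [IrelandRosen1990] Prop. 5.1.2, §8.1; [SilvermanAEC2009] V.1.
-/

set_option autoImplicit false

namespace Summit.BirchSwinnertonDyer.Rank1Residual.Supersingular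

open Literature.NumberTheory.EllipticCurves
  Literature.NumberTheory.EllipticCurves.Rank1Residual.X11RankOneCertificates
  Summit.BirchSwinnertonDyer.Rank1Residual.X11b

/-- **The schema count in pow form**: `countPoints [a₁,…,a₆] ℓ` equals the same column sum with
Euler's criterion evaluated as `r ^ ((ℓ−1)/2) % ℓ` (`powMod_eq`). [cite: IrelandRosen1990, Prop. 5.1.2 (Euler's criterion)] -/
theorem countPoints_eq_powForm (a1 a2 a3 a4 a6 : ℤ) (ℓ : ℕ) :
    countPoints [a1, a2, a3, a4, a6] ℓ = 1 + ((List.range ℓ).map fun (x : ℕ) =>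
      1 + (if (((a1 * x + a3) * (a1 * x + a3) + 4 * ((x : ℤ) * x * x + a2 * x * x + a4 * x + a6)) %
              (ℓ : ℤ)).toNat = 0 then (0 : ℤ)
           else if (((a1 * x + a3) * (a1 * x + a3) + 4 * ((x : ℤ) * x * x + a2 * x * x + a4 * x + a6)) %
              (ℓ : ℤ)).toNat ^ ((ℓ - 1) / 2) % ℓ = 1 then 1 else -1)).sum := by
  simp only [countPoints, Literature.NumberTheory.EllipticCurves.Rank1Residual.X11RankOneCertificates.legendreSym,
    powMod_eq]

/-- **`#Ẽ(𝔽_ℓ) = n` from the pow-form count** at an odd prime `ℓ ∤ Δ` (`natCard_point_eq_of_countPoints`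
after `countPoints_eq_powForm`). [cite: IrelandRosen1990, Prop. 5.1.2 and §8.1] -/
theorem natCard_point_eq_of_powForm (a1 a2 a3 a4 a6 : ℤ) (ℓ : ℕ) [Fact ℓ.Prime] (hℓ2 : ℓ ≠ 2)
    (hℓΔ : ¬ (ℓ : ℤ) ∣ discOf [a1, a2, a3, a4, a6]) {n : ℕ}
    (hc : 1 + ((List.range ℓ).map fun (x : ℕ) =>
      1 + (if (((a1 * x + a3) * (a1 * x + a3) + 4 * ((x : ℤ) * x * x + a2 * x * x + a4 * x + a6)) %
              (ℓ : ℤ)).toNat = 0 then (0 : ℤ)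
           else if (((a1 * x + a3) * (a1 * x + a3) + 4 * ((x : ℤ) * x * x + a2 * x * x + a4 * x + a6)) %
              (ℓ : ℤ)).toNat ^ ((ℓ - 1) / 2) % ℓ = 1 then 1 else -1)).sum = n) :
    Nat.card (((⟨a1, a2, a3, a4, a6⟩ : WeierstrassCurve ℤ).map
      (Int.castRingHom (ZMod ℓ))).toAffine.Point) = n :=
  natCard_point_eq_of_countPoints a1 a2 a3 a4 a6 ℓ hℓ2 hℓΔ (by rw [countPoints_eq_powForm]; exact hc)

/-- Regression test of the kernel path at the largest supersingular prime of the census: the Cremona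
model `284130v1 = [1, -1, 0, -1307745, -575218179]` has `#Ẽ(𝔽_4919) = 4920` (`a_4919 = 0`). [folklore] -/
theorem powForm_test_284130v1_4919 :
    1 + ((List.range 4919).map fun (x : ℕ) =>
      1 + (if (((1 * x + 0) * (1 * x + 0) + 4 * ((x : ℤ) * x * x + (-1) * x * x + (-1307745) * x +
              (-575218179))) % ((4919 : ℕ) : ℤ)).toNat = 0 then (0 : ℤ)
           else if (((1 * x + 0) * (1 * x + 0) + 4 * ((x : ℤ) * x * x + (-1) * x * x + (-1307745) * x +
              (-575218179))) % ((4919 : ℕ) : ℤ)).toNat ^ ((4919 - 1) / 2) % 4919 = 1 then 1 else -1)).sum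
      = 4920 := by
  decide +kernel

end Summit.BirchSwinnertonDyer.Rank1Residual.Supersingular
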